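import Mathlib.MeasureTheory.Function.Jacobian
import Mathlib.Analysis.Calculus.InverseFunctionTheorem.FDeriv
import Mathlib.Analysis.Calculus.ContDiff.RCLike
import Mathlib.Data.Real.Sign
import Mathlib.Topology.Algebra.Module.FiniteDimension
import Mathlib.Analysis.Normed.Module.FiniteDimension
import HarnessLib

/-!
# The local degree formula at non-degenerate zeros

Topic `Literature/Analysis/Calculus`. Let `f : E → E` be a `C¹` self-map of a finite-dimensional
real normed space, `K` compact, `U ⊆ K` open, and suppose the zeros of `f` in `K` form a finite
set `Z ⊆ U` of *non-degenerate* zeros (`det Df(z) ≠ 0`). Then for every continuous weight `φ`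
supported in a sufficiently small ball around `0`,

  `∫_K φ(f x) · det Df(x) dx = (∫ φ) · ∑_{z ∈ Z} sign det Df(z)`

(`setIntegral_comp_mul_det_eq_integral_mul_sum_sign`). This is formula (3.5) of Chang,
*Methods in Nonlinear Analysis* (2005), §3.1 — the bridge between the "sum of signs of the
Jacobian over the preimages of a regular value" definition (3.4) of the Brouwer degree and its
integral (de Rham) form: around each zero `f` is a diffeomorphism of a small ball (inverse function
theorem), `det Df` has constant sign there, the change-of-variables formula
(`MeasureTheory.integral_image_eq_integral_abs_det_fderiv_smul`) turns
`∫_{ball} φ(f)|det Df|` into `∫ φ`, and off the balls `‖f‖` is bounded below on the compact set `K`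
so that `φ ∘ f` vanishes there.

Used in `Literature/Topology/Euclidean/PoincareHopfTorus.lean` (index sum of a periodic vector
field is zero). No definitions, no `sorry`.

## References

* K.-C. Chang, *Methods in Nonlinear Analysis* (2005), §3.1, (3.4)–(3.5). [Chang2005]
-/

noncomputable section

open MeasureTheory Set Function Metric Filter
open scoped Topology

namespace Literature.Analysis.Calculus

/-! ### Small helpers -/

/-- `sign r · |r| = r`. [folklore] -/
theorem sign_mul_abs_eq (r : ℝ) : Real.sign r * |r| = r := by
  rcases lt_trichotomy r 0 with hr | rfl | hr
  · rw [Real.sign_of_neg hr, abs_of_neg hr]; ring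
  · simp
  · rw [Real.sign_of_pos hr, abs_of_pos hr]; ring

/-- Two reals closer to each other than the modulus of the second have the same sign. [folklore] -/
theorem sign_eq_sign_of_abs_sub_lt {a b : ℝ} (h : |a - b| < |b|) : Real.sign a = Real.sign b := by
  rcases lt_trichotomy b 0 with hb | rfl | hb
  · rw [abs_of_neg hb] at h
    have ha : a < 0 := by
      have := (abs_lt.1 h).2
      linarith
    rw [Real.sign_of_neg ha, Real.sign_of_neg hb]
  · exact absurd ((abs_nonneg a).trans_lt (by simpa using h)) (lt_irrefl 0)
  · rw [abs_of_pos hb] at h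
    have ha : 0 < a := by
      have := (abs_lt.1 h).1
      linarith
    rw [Real.sign_of_pos ha, Real.sign_of_pos hb]

/-- A positive lower bound for finitely many positive reals. [folklore] -/
theorem exists_pos_forall_le_of_finset {ι : Type*} (s : Finset ι) (g : ι → ℝ)
    (h : ∀ i ∈ s, 0 < g i) : ∃ δ > 0, ∀ i ∈ s, δ ≤ g i := by
  rcases s.eq_empty_or_nonempty with rfl | hne
  · exact ⟨1, one_pos, by simp⟩
  · obtain ⟨i₀, hi₀, hmin⟩ := s.exists_min_image g hne
    exact ⟨g i₀, h i₀ hi₀, hmin⟩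

/-- Finitely many points of a metric space are uniformly separated. [folklore] -/
theorem exists_pos_forall_le_dist {X : Type*} [MetricSpace X] [DecidableEq X] (s : Finset X) :
    ∃ ρ > 0, ∀ z ∈ s, ∀ z' ∈ s, z ≠ z' → ρ ≤ dist z z' := by
  obtain ⟨ρ, hρ, hle⟩ := exists_pos_forall_le_of_finset s.offDiag (fun q => dist q.1 q.2)
    (fun q hq => dist_pos.2 (Finset.mem_offDiag.1 hq).2.2)
  exact ⟨ρ, hρ, fun z hz z' hz' hne => hle (z, z') (Finset.mem_offDiag.2 ⟨hz, hz', hne⟩)⟩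

/-! ### The local degree formula -/

variable {E : Type*} [NormedAddCommGroup E] [NormedSpace ℝ E] [FiniteDimensional ℝ E]
  [MeasurableSpace E] [BorelSpace E]

/-- **Local degree formula at non-degenerate zeros** (Chang 2005, §3.1, (3.4)–(3.5)). Let
`f : E → E` be `C¹`, `K` compact, `U ⊆ K` open, `Z ⊆ U` a finite set containing every zero of
`f` in `K` and consisting of non-degenerate zeros (`f z = 0`, `det Df(z) ≠ 0`). Then there is
`δ > 0` such that for every continuous `φ : E → ℝ` vanishing on `{‖v‖ ≥ δ}`,
`∫_K φ(f x) det Df(x) dμ = (∫ φ dμ) · ∑_{z ∈ Z} sign det Df(z)` (`μ` an additive Haar measure).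
Proof: disjoint balls `B_z ⊆ U` on which `f` is injective (inverse function theorem) and
`sign det Df` is constant, with `f(B_z) ⊇ ball 0 δ` (open mapping) and `‖f‖ ≥ δ` on the compact
set `K ∖ ⋃ B_z`; then `∫_K = ∑_z ∫_{B_z} φ(f) det Df = ∑_z sign_z ∫_{B_z} φ(f) |det Df|
= ∑_z sign_z ∫_{f(B_z)} φ = ∑_z sign_z ∫ φ` by the change of variables formula.
[cite: Chang2005, §3.1 (3.5)] -/
theorem setIntegral_comp_mul_det_eq_integral_mul_sum_sign (μ : Measure E) [μ.IsAddHaarMeasure]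
    {f : E → E} (hf : ContDiff ℝ 1 f) {K U : Set E} (hK : IsCompact K) (hU : IsOpen U)
    (hUK : U ⊆ K) {Z : Finset E} (hZU : ↑Z ⊆ U) (hZ : ∀ x ∈ K, f x = 0 → x ∈ Z)
    (hZ0 : ∀ z ∈ Z, f z = 0) (hnd : ∀ z ∈ Z, (fderiv ℝ f z).det ≠ 0) :
    ∃ δ > 0, ∀ φ : E → ℝ, Continuous φ → (∀ v, δ ≤ ‖v‖ → φ v = 0) →
      ∫ x in K, φ (f x) * (fderiv ℝ f x).det ∂μ =
        (∫ v, φ v ∂μ) * ∑ z ∈ Z, Real.sign (fderiv ℝ f z).det := by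
  classical
  have hfd : Differentiable ℝ f := hf.differentiable one_ne_zero
  have hfc1 : Continuous (fderiv ℝ f) := hf.continuous_fderiv one_ne_zero
  have hdetc : Continuous fun x => (fderiv ℝ f x).det :=
    ContinuousLinearMap.continuous_det.comp hfc1
  -- Step 1: separation of the zeros
  obtain ⟨ρ, hρ, hρZ⟩ := exists_pos_forall_le_dist Z
  -- Step 2: good radii around each zero
  have hloc : ∀ z ∈ Z, ∃ r > 0, ball z r ⊆ U ∧ InjOn f (ball z r) ∧
      (∀ x ∈ ball z r, Real.sign (fderiv ℝ f x).det = Real.sign (fderiv ℝ f z).det) ∧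
      f '' ball z r ∈ 𝓝 (0 : E) ∧ 2 * r ≤ ρ := by
    intro z hz
    set A := (fderiv ℝ f z).toContinuousLinearEquivOfDetNeZero (hnd z hz) with hA
    have hAe : (A : E →L[ℝ] E) = fderiv ℝ f z :=
      (fderiv ℝ f z).coe_toContinuousLinearEquivOfDetNeZero _
    have hsd : HasStrictFDerivAt f (A : E →L[ℝ] E) z := by
      rw [hAe]
      exact hf.contDiffAt.hasStrictFDerivAt one_ne_zero
    set Φ := hsd.toOpenPartialHomeomorph f with hΦ
    have hsrc : Φ.source ∈ 𝓝 z :=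
      Φ.open_source.mem_nhds hsd.mem_toOpenPartialHomeomorph_source
    have hsgn : ∀ᶠ x in 𝓝 z, |(fderiv ℝ f x).det - (fderiv ℝ f z).det| < |(fderiv ℝ f z).det| := by
      have h := Metric.tendsto_nhds.1 (hdetc.continuousAt (x := z)) _ (abs_pos.2 (hnd z hz))
      simpa [Real.dist_eq] using h
    obtain ⟨r₁, hr₁, hball⟩ := Metric.mem_nhds_iff.1
      (inter_mem (inter_mem hsrc (hU.mem_nhds (hZU hz))) hsgn)
    have hsub : ball z (min r₁ (ρ / 2)) ⊆ ball z r₁ := ball_subset_ball (min_le_left _ _)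
    refine ⟨min r₁ (ρ / 2), lt_min hr₁ (half_pos hρ), fun x hx => (hball (hsub hx)).1.2, ?_,
      fun x hx => sign_eq_sign_of_abs_sub_lt (hball (hsub hx)).2, ?_, ?_⟩
    · exact Φ.injOn.mono fun x hx => (hball (hsub hx)).1.1
    · rw [← hZ0 z hz, ← hsd.map_nhds_eq_of_equiv]
      exact image_mem_map (ball_mem_nhds z (lt_min hr₁ (half_pos hρ)))
    · linarith [min_le_right r₁ (ρ / 2)]
  choose! r hr using hloc
  have hr0 : ∀ z ∈ Z, 0 < r z := fun z hz => (hr z hz).1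
  have hrU : ∀ z ∈ Z, ball z (r z) ⊆ U := fun z hz => (hr z hz).2.1
  have hinj : ∀ z ∈ Z, InjOn f (ball z (r z)) := fun z hz => (hr z hz).2.2.1
  have hsgn : ∀ z ∈ Z, ∀ x ∈ ball z (r z),
      Real.sign (fderiv ℝ f x).det = Real.sign (fderiv ℝ f z).det := fun z hz => (hr z hz).2.2.2.1
  have himg : ∀ z ∈ Z, f '' ball z (r z) ∈ 𝓝 (0 : E) := fun z hz => (hr z hz).2.2.2.2.1
  have hrρ : ∀ z ∈ Z, 2 * r z ≤ ρ := fun z hz => (hr z hz).2.2.2.2.2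
  -- Step 3: the radius `δ`
  have hδz : ∀ z ∈ Z, ∃ δ > 0, ball (0 : E) δ ⊆ f '' ball z (r z) := fun z hz =>
    Metric.mem_nhds_iff.1 (himg z hz)
  choose! δz hδz using hδz
  obtain ⟨δ₁, hδ₁, hδ₁le⟩ := exists_pos_forall_le_of_finset Z δz fun z hz => (hδz z hz).1
  set S := K \ ⋃ z ∈ Z, ball z (r z) with hS
  have hSc : IsCompact S := hK.diff (isOpen_biUnion fun z _ => isOpen_ball)
  have hSf : ∀ x ∈ S, f x ≠ 0 := by
    rintro x ⟨hxK, hxU⟩ hfx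
    apply hxU
    have hxZ := hZ x hxK hfx
    exact mem_biUnion hxZ (mem_ball_self (hr0 x hxZ))
  obtain ⟨δ₂, hδ₂, hδ₂le⟩ : ∃ δ₂ > 0, ∀ x ∈ S, δ₂ ≤ ‖f x‖ := by
    rcases S.eq_empty_or_nonempty with hSe | hSne
    · refine ⟨1, one_pos, fun x hx => ?_⟩
      rw [hSe] at hx
      exact absurd hx (notMem_empty x)
    · obtain ⟨x₀, hx₀, hmin⟩ := hSc.exists_isMinOn hSne hf.continuous.norm.continuousOn
      exact ⟨‖f x₀‖, norm_pos_iff.2 (hSf x₀ hx₀), fun x hx => hmin hx⟩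
  refine ⟨min δ₁ δ₂, lt_min hδ₁ hδ₂, fun φ hφc hφ0 => ?_⟩
  -- Step 4: the computation
  set g : E → ℝ := fun x => φ (f x) * (fderiv ℝ f x).det with hg
  have hgc : Continuous g := (hφc.comp hf.continuous).mul hdetc
  have hgi : ∀ s ⊆ K, IntegrableOn g s μ := fun s hs =>
    (hgc.continuousOn.integrableOn_compact hK).mono_set hs
  have hballsK : (⋃ z ∈ Z, ball z (r z)) ⊆ K :=
    iUnion₂_subset fun z hz => (hrU z hz).trans hUK
  -- (i) the integrand vanishes off the balls
  have h1 : ∫ x in K, g x ∂μ = ∫ x in ⋃ z ∈ Z, ball z (r z), g x ∂μ := by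
    refine setIntegral_eq_of_subset_of_forall_sdiff_eq_zero hK.measurableSet hballsK ?_
    intro x hx
    have hx' : δ₂ ≤ ‖f x‖ := hδ₂le x hx
    simp only [hg]
    rw [hφ0 (f x) ((min_le_right _ _).trans hx'), zero_mul]
  -- (ii) the balls are disjoint
  have h2 : ∫ x in ⋃ z ∈ Z, ball z (r z), g x ∂μ = ∑ z ∈ Z, ∫ x in ball z (r z), g x ∂μ := by
    refine integral_biUnion_finset Z (fun z _ => measurableSet_ball) ?_
      (fun z hz => hgi _ ((hrU z hz).trans hUK))
    intro z hz z' hz' hne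
    refine ball_disjoint_ball ?_
    have h₁ := hρZ z hz z' hz' hne
    have h₂ := hrρ z hz
    have h₃ := hrρ z' hz'
    linarith
  -- (iii) each ball contributes `sign det Df(z) · ∫ φ`
  have h3 : ∀ z ∈ Z, ∫ x in ball z (r z), g x ∂μ =
      Real.sign (fderiv ℝ f z).det * ∫ v, φ v ∂μ := by
    intro z hz
    have hcv := integral_image_eq_integral_abs_det_fderiv_smul μ measurableSet_ball
      (fun x _ => (hfd x).hasFDerivAt.hasFDerivWithinAt) (hinj z hz) φ
    have hfull : ∫ v in f '' ball z (r z), φ v ∂μ = ∫ v, φ v ∂μ := by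
      apply setIntegral_eq_integral_of_forall_compl_eq_zero
      intro v hv
      by_contra hne
      apply hv
      apply (hδz z hz).2
      rw [mem_ball_zero_iff]
      by_contra hge
      push Not at hge
      exact hne (hφ0 v ((min_le_left _ _).trans ((hδ₁le z hz).trans hge)))
    calc ∫ x in ball z (r z), g x ∂μ
        = ∫ x in ball z (r z),
            Real.sign (fderiv ℝ f z).det * (|(fderiv ℝ f x).det| • φ (f x)) ∂μ := by
          refine setIntegral_congr_fun measurableSet_ball fun x hx => ?_
          simp only [hg, smul_eq_mul]
          rw [← hsgn z hz x hx]
          conv_lhs => rw [← sign_mul_abs_eq (fderiv ℝ f x).det]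
          ring
      _ = Real.sign (fderiv ℝ f z).det *
            ∫ x in ball z (r z), |(fderiv ℝ f x).det| • φ (f x) ∂μ := integral_const_mul _ _
      _ = Real.sign (fderiv ℝ f z).det * ∫ v, φ v ∂μ := by rw [← hcv, hfull]
  rw [h1, h2, Finset.sum_congr rfl h3, Finset.mul_sum]
  exact Finset.sum_congr rfl fun z _ => mul_comm _ _

end Literature.Analysis.Calculus
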